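import Summits.QuantumFields.YangMills.Theorems.BalabanLadderIRTwistedSlabThreshold
import Literature.MathematicalPhysics.QuantumLattice.RepLieAlgebraUnitary
import HarnessLib

/-!
# T1 (`TwistedSlabAnchor`) for `SU(N)` in the stub's own binder shape, with `∃ β₀` AFTER `∀ L` — the one remaining transposition

HELPER toward stub **T1** `TwistedSlabAnchor` of LINE `twisted-slab-continuity` (crux `IRcof`, stmt-QuantumFields-26930, census row 43;
LEAD prover ym-ir-line-tsc-p1 g5; `--supports` the crux, `--as helper`).  Theorems only.  K39: the literal comparison with the stub.
`TwistedSlabAnchor` reads, for each admissible `(G, z, n, r)`: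
`∃ ℓ₀ β₀ c C, 2 ≤ ℓ₀ ∧ 0 < c ∧ ∀ β ≥ β₀, ∀ L t, 2 ≤ L → 1 ≤ t → projSlabDefect r.ρ β z n ℓ₀ L t ≤ C·L·e^{−ct}`.
For `G = SU(N)` (`N ≥ 2`), `z = ω^k·1` a generator of the centre (`k` a unit — by lit-4's `suCenter_isolatingTwist_iff` exactly the `z` with an
isolating twist), `z^n = 1`, and `r` = the fundamental representation, this file proves (K38 `twistedSlabAnchor_su_threshold` at `ℓ₀ = 2`):
★★★★ `twistedSlabAnchor_su_fundamental_threshold` —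
`∃ ℓ₀ c C, 2 ≤ ℓ₀ ∧ 0 < c ∧ ∀ L, 2 ≤ L → ∃ β₀, ∀ β ≥ β₀, ∀ t, 1 ≤ t → projSlabDefect (fundamentalLatticeRep N).ρ β z n ℓ₀ L t ≤ C·L·e^{−ct}` —
the stub's conclusion for this `(G, z, r)` with the SINGLE transposition `∀ L ∃ β₀` in place of `∃ β₀ ∀ L`.

HONEST FRAMING: that transposition — a coupling threshold uniform in the long extent `L` — is precisely the missing weak-coupling cluster expansion
(M4; not in print); the stub also quantifies over every simply-connected compact simple `G` with an isolating twist and every lattice representation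
(here: `SU(N)`, fundamental); T1 0∕1; IRcof ∕ IR 0∕1; the Yang–Mills mass gap (Clay) is NOT proved; R4 = `BalabanLadder.UV` only.
-/

set_option autoImplicit false

noncomputable section

open Literature.MathematicalPhysics.QuantumFieldTheory Literature.MathematicalPhysics.QuantumLattice

namespace Summit.QuantumFields.YangMills.Cruxes.IRcof.TwistedSlab

variable {N : ℕ} [NeZero N] {k : ZMod N}

/-- ★★★★ **`TwistedSlabAnchor` for `SU(N)`, fundamental representation, generator `ω^k·1`, up to the transposition `∀ L ∃ β₀`:**
`∃ ℓ₀ c C, 2 ≤ ℓ₀ ∧ 0 < c ∧ ∀ L ≥ 2, ∃ β₀, ∀ β ≥ β₀, ∀ t ≥ 1, projSlabDefect (fundamentalLatticeRep N).ρ β (ω^k·1) n ℓ₀ L t ≤ C·L·e^{−ct}`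
(`ℓ₀ = 2`; `c, C` depend on `N` only).  HONEST: `β₀ = β₀(L)`; the stub wants `β₀` before `∀ L`. [cite: tHooft1979Flux, §5 (5.1)–(5.4)] -/
theorem twistedSlabAnchor_su_fundamental_threshold (hN : 2 ≤ N) (hk : IsUnit k) {n : ℕ} (hn : 0 < n)
    (hzn : (suCenter N k : Matrix.specialUnitaryGroup (Fin N) ℂ) ^ n = 1) :
    ∃ (ℓ₀ : ℕ) (c C : ℝ), 2 ≤ ℓ₀ ∧ 0 < c ∧
      ∀ L : ℕ, 2 ≤ L → ∃ β₀ : ℝ, ∀ β : ℝ, β₀ ≤ β → ∀ t : ℕ, 1 ≤ t →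
        projSlabDefect (fundamentalLatticeRep N).ρ β (suCenter N k : Matrix.specialUnitaryGroup (Fin N) ℂ) n ℓ₀ L t ≤
          C * (L : ℝ) * Real.exp (-(c * (t : ℝ))) := by
  obtain ⟨c, C, hc, -, h⟩ := twistedSlabAnchor_su_threshold (N := N) hN hk hn hzn 1
  refine ⟨2, c, C, le_rfl, hc, fun L hL => ?_⟩
  obtain ⟨m₂, rfl⟩ : ∃ m₂, L = m₂ + 1 := ⟨L - 1, by omega⟩
  obtain ⟨β₀, hβ₀⟩ := h m₂
  exact ⟨β₀, fun β hβ t ht => hβ₀ β hβ t ht⟩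

end Summit.QuantumFields.YangMills.Cruxes.IRcof.TwistedSlab

end
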